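import Summits.CriticalPhenomena.PercolationContinuityZ3.Theorems.PercNearOneGluingNoHeavyLowerTailSunflowerCycleEdge
import Summits.CriticalPhenomena.PercolationContinuityZ3.Theorems.PercNearOneGluingNoHeavyLowerTailSunflowerLeafLeaf
import HarnessLib

/-!
# `NoHeavyLowerTail` (crux stmt-CriticalPhenomena-4575), abstract sunflower cubic: EVERY CYCLE `C_n` (`n ≥ 6`) HAS AN A-SAFE CORE —
# CONDITIONALLY ON THE TWO ANALYTIC INEQUALITIES `GradedTBern` AND `EdgeLemma`

Support file (seat `prim-ineq-prove-1` gen 68; `--supports stmt-CriticalPhenomena-4575`).  No `sorry`; the two conjecture-shaped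
inequalities enter as hypotheses (`…SunflowerTwoLevelPendant`, `…SunflowerEdgeDecomposition`).  Memo:
run/shared/lean/prim/prim-ineq-prove-1/FINDING-EDGE-prove1-g68.md §5.

The instance of `aSafe_edgeCore_close_leaves` (`…SunflowerCycleEdge`) for the cycle: `C_{m+6}` (written `m+3+3`) is the path on the vertices
`1, …, m+4` closed up by the path `1 – 0 – (m+5) – (m+4)`; the inner path and its two sub-paths `2…m+4`, `1…m+3` are bipartite, hence
A-safe (`Bridge.safe_edgeCore_of_bipartite`).  **`safe_edgeCore_cycleGraph_of_inequalities`**: `GradedTBern` ∧ `EdgeLemma` (on their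
parameter ranges) ⟹ `Safe p (edgeCore (cycleGraph n))` for every `n ≥ 6` and every `p` — compare `safe_edgeCore_cycleGraph_of_leafLeafSafe`
(`…SunflowerLeafLeaf`), whose hypothesis `LeafLeafSafe` is thereby bypassed for cycles.
-/

namespace Summit.CriticalPhenomena.PercolationContinuityZ3.Theorems.SunflowerPartition

namespace SafeCalc

namespace EdgeDecomp

open Finset LinkedCurrency

/-- The path on the vertices `lo, lo+1, …, hi` of `Fin N` (consecutive vertices adjacent), everything else isolated. [this work] -/
def segPath (N lo hi : ℕ) : SimpleGraph (Fin N) :=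
  SimpleGraph.fromRel fun u v => u.val + 1 = v.val ∧ lo ≤ u.val ∧ v.val ≤ hi

/-- Adjacency in a segment path: consecutive values inside `[lo, hi]`. [this work] -/
theorem segPath_adj {N lo hi : ℕ} {u v : Fin N} :
    (segPath N lo hi).Adj u v ↔ (u.val + 1 = v.val ∧ lo ≤ u.val ∧ v.val ≤ hi) ∨ (v.val + 1 = u.val ∧ lo ≤ v.val ∧ u.val ≤ hi) := by
  rw [segPath, SimpleGraph.fromRel_adj]
  constructor
  · rintro ⟨-, h⟩; exact h
  · intro h
    refine ⟨fun e => ?_, h⟩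
    rw [Fin.ext_iff] at e
    omega

/-- A segment path is bipartite (even / odd vertices), hence its core is safe at every `p`. [this work] -/
theorem safe_edgeCore_segPath (N lo hi : ℕ) (p : Fin N → unitInterval) : Safe p (edgeCore (segPath N lo hi)) := by
  classical
  refine Bridge.safe_edgeCore_of_bipartite _ (univ.filter fun v : Fin N => v.val % 2 = 0) (fun u v huv => ?_) p
  simp only [mem_filter, mem_univ, true_and]
  rw [segPath_adj] at huv
  omega

/-- The cycle `C_{m+6}` is the segment path `1 … m+4` plus the edges `{0, m+5}`, `{0, 1}`, `{m+5, m+4}`. [this work] -/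
theorem cycleGraph_eq_segPath_sup (m : ℕ) :
    SimpleGraph.cycleGraph (m + 3 + 3) = segPath (m + 3 + 3) 1 (m + 4) ⊔
      SimpleGraph.fromEdgeSet {s((0 : Fin (m + 3 + 3)), Fin.last (m + 3 + 2))} ⊔
      SimpleGraph.fromEdgeSet {s((0 : Fin (m + 3 + 3)), (⟨1, by omega⟩ : Fin (m + 3 + 3)))} ⊔
      SimpleGraph.fromEdgeSet {s(Fin.last (m + 3 + 2), (⟨m + 4, by omega⟩ : Fin (m + 3 + 3)))} := by
  rw [cycleGraph_eq_pathGraph_sup_edge (m + 3)]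
  ext u v
  simp only [SimpleGraph.sup_adj, SimpleGraph.fromEdgeSet_adj, Set.mem_singleton_iff, Sym2.eq_iff, SimpleGraph.pathGraph_adj,
    segPath_adj, ne_eq, Fin.ext_iff, Fin.val_zero, Fin.val_last]
  have hu := u.isLt; have hv := v.isLt
  constructor
  · intro h; omega
  · intro h; omega

/-- The inner path is its sub-path `2 … m+4` plus the pendant edge `{2, 1}`. [this work] -/
theorem segPath_eq_left (m : ℕ) :
    segPath (m + 3 + 3) 1 (m + 4) = segPath (m + 3 + 3) 2 (m + 4) ⊔
      SimpleGraph.fromEdgeSet {s((⟨2, by omega⟩ : Fin (m + 3 + 3)), (⟨1, by omega⟩ : Fin (m + 3 + 3)))} := by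
  ext u v
  simp only [SimpleGraph.sup_adj, SimpleGraph.fromEdgeSet_adj, Set.mem_singleton_iff, Sym2.eq_iff, segPath_adj, ne_eq, Fin.ext_iff]
  constructor
  · intro h; omega
  · intro h; omega

/-- The inner path is its sub-path `1 … m+3` plus the pendant edge `{m+3, m+4}`. [this work] -/
theorem segPath_eq_right (m : ℕ) :
    segPath (m + 3 + 3) 1 (m + 4) = segPath (m + 3 + 3) 1 (m + 3) ⊔
      SimpleGraph.fromEdgeSet {s((⟨m + 3, by omega⟩ : Fin (m + 3 + 3)), (⟨m + 4, by omega⟩ : Fin (m + 3 + 3)))} := by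
  ext u v
  simp only [SimpleGraph.sup_adj, SimpleGraph.fromEdgeSet_adj, Set.mem_singleton_iff, Sym2.eq_iff, segPath_adj, ne_eq, Fin.ext_iff]
  constructor
  · intro h; omega
  · intro h; omega

/-- **EVERY CYCLE `C_{m+6}` HAS A CORE THAT IS SAFE AT EVERY `p`, conditionally on `GradedTBern` and `EdgeLemma`.** [this work] -/
theorem safe_edgeCore_cycleGraph_add_six
    (hG : ∀ s b β : ℝ, 0 < b → b ≤ β → β ≤ 1 → 0 ≤ s → s ≤ 1 → GradedTBern s b β)
    (hE : ∀ p r g₀ gL gR : ℝ, 0 ≤ p → p ≤ 1 → 0 ≤ r → r ≤ 1 → 0 < g₀ → g₀ ≤ gL → gL ≤ 1 → g₀ ≤ gR → gR ≤ 1 →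
      EdgeLemma p r g₀ gL gR)
    (m : ℕ) (p : Fin (m + 3 + 3) → unitInterval) : Safe p (edgeCore (SimpleGraph.cycleGraph (m + 3 + 3))) := by
  classical
  set a : Fin (m + 3 + 3) := 0 with ha
  set b : Fin (m + 3 + 3) := Fin.last (m + 3 + 2) with hb
  set c : Fin (m + 3 + 3) := ⟨1, by omega⟩ with hc
  set c' : Fin (m + 3 + 3) := ⟨2, by omega⟩ with hc'
  set d : Fin (m + 3 + 3) := ⟨m + 4, by omega⟩ with hd
  set d' : Fin (m + 3 + 3) := ⟨m + 3, by omega⟩ with hd'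
  have hav : a.val = 0 := rfl
  have hbv : b.val = m + 3 + 2 := rfl
  rw [cycleGraph_eq_segPath_sup m]
  refine aSafe_edgeCore_close_leaves (a := a) (b := b) (c := c) (d := d) (c' := c') (d' := d') ?_ ?_ ?_ ?_ ?_ ?_ ?_
    (segPath (m + 3 + 3) 1 (m + 4)) (segPath (m + 3 + 3) 2 (m + 4)) (segPath (m + 3 + 3) 1 (m + 3))
    (segPath_eq_left m) ?_ (segPath_eq_right m) ?_ ?_ ?_
    (fun q => safe_edgeCore_segPath _ _ _ q) (fun q => safe_edgeCore_segPath _ _ _ q) (fun q => safe_edgeCore_segPath _ _ _ q)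
    ?_ ?_ hG hE p
  · rw [ne_eq, Fin.ext_iff, hav, hbv]; omega
  · rw [ne_eq, Fin.ext_iff, hav]; simp [c]
  · rw [ne_eq, Fin.ext_iff, hbv]; simp [c]
  · rw [ne_eq, Fin.ext_iff, hav]; simp [d]
  · rw [ne_eq, Fin.ext_iff, hbv]; simp [d]
  · rw [ne_eq, Fin.ext_iff]; simp [c, c']
  · rw [ne_eq, Fin.ext_iff]; simp [d, d']
  · intro w h; rw [segPath_adj] at h; simp only [hc] at h; omega
  · intro w h; rw [segPath_adj] at h; simp only [hd] at h; omega
  · intro w h; rw [segPath_adj, hav] at h; omega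
  · intro w h; rw [segPath_adj, hbv] at h; omega
  · refine ⟨⟨3, by omega⟩, ⟨4, by omega⟩, ?_, ?_, ?_⟩
    · rw [segPath_adj]; left; simp
    · simp [c', Fin.ext_iff]
    · simp [c', Fin.ext_iff]
  · refine ⟨⟨1, by omega⟩, ⟨2, by omega⟩, ?_, ?_, ?_⟩
    · rw [segPath_adj]; left; simp
    · simp [d', Fin.ext_iff]
    · simp [d', Fin.ext_iff]

/-- **Every cycle `C_n`, `n ≥ 6`, has a core that is safe at every `p` — conditionally on `GradedTBern` and `EdgeLemma`.**
(`C₄` is bipartite and `C₅` is in the tree unconditionally.) [this work] -/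
theorem safe_edgeCore_cycleGraph_of_inequalities
    (hG : ∀ s b β : ℝ, 0 < b → b ≤ β → β ≤ 1 → 0 ≤ s → s ≤ 1 → GradedTBern s b β)
    (hE : ∀ p r g₀ gL gR : ℝ, 0 ≤ p → p ≤ 1 → 0 ≤ r → r ≤ 1 → 0 < g₀ → g₀ ≤ gL → gL ≤ 1 → g₀ ≤ gR → gR ≤ 1 →
      EdgeLemma p r g₀ gL gR)
    (n : ℕ) (hn : 6 ≤ n) (p : Fin n → unitInterval) : Safe p (edgeCore (SimpleGraph.cycleGraph n)) := by
  obtain ⟨m, rfl⟩ : ∃ m, n = m + 3 + 3 := ⟨n - 6, by omega⟩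
  exact safe_edgeCore_cycleGraph_add_six hG hE m p

end EdgeDecomp

end SafeCalc

end Summit.CriticalPhenomena.PercolationContinuityZ3.Theorems.SunflowerPartition
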